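import Mathlib
import HarnessLib
import Summits.MatrixMultiplication.MatrixMultiplication.Theses.SnSubsetDichotomy
import Summits.MatrixMultiplication.MatrixMultiplication.Theorems.SnSubsetDichotomyHyperoctahedralSubsetsGroupPacking
import Summits.MatrixMultiplication.MatrixMultiplication.Theorems.SnSubsetDichotomyHyperoctahedralSubsetsPairwisePacking
import Summits.MatrixMultiplication.MatrixMultiplication.Theorems.SnSubsetDichotomyHyperoctahedralSubsetsHostSquare

/-!
# Line `spherical-rank-sieve` (lead's reshape, 2026-08-16) — crux `SnSubsetDichotomy.HyperoctahedralSubsets`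
(stmt-MatrixMultiplication-8305)

Lead prover: prover-line-stmt-MatrixMultiplication-8305-0.  This is the OWNED skeleton of the picked line (L1), reshaped at
the long-cycle branch (L4 "reshape: different stub set with the same composition idea").  The planner's skeleton
(`Lines/spherical-rank-sieve.lean`, planner-cruxplan-…-spherical-rank-sieve-0) is the regime split on the alternating-cycle
structure of a host pair; its short-cycle branch (Stubs 1–2: many alternating cycles ⇒ large host intersection ⇒ pairwise
packing inside the hosts) is kept VERBATIM (same names, same registered signatures); its long-cycle branch (Stubs 3–5:
zonal rank decay [XL, Gelfand pair `(S_{2m}, B_m)`, none of it in Mathlib] + robust rank sieve + the OPEN residual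
`stub_unsaturatedMiddle`, "most of the crux") is replaced by the GROUP-PACKING reduction — the lead's reconstruction of
the candidate proof attached to this item by the twin crux's disprover (`hyperoctahedralSubsets_of_packing :
LocalTriplePacking → HyperoctahedralSubsets`, evidence Disproof.lean 2026-08-15T23:21:57Z; the evidence store is not
mounted in prover/planner jails, so the argument below is independent).

THE CRUX. `HyperoctahedralSubsets`: `∃ c > 0, n₀: ∀ n ≥ n₀`, three fixed-point-free involutions `μ_i` (perfect matchings
`M_i`, hosts `B_i = C(μ_i) ≅ S_2 ≀ S_{n/2}`, `|B_i| = 2^m m!`, `n = 2m`) and `X_i ⊆ B_i` with the triple product property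
have `vol := |X₀||X₁||X₂| ≤ (n!)^{3/2} e^{−c√n}`.  Recall `|B|³ = (n!)^{3/2}(πn/2)^{3/4}(1+o(1))`: a saving `n^{3/4}e^{c√n}`
is needed.

THE LINE (regime split on the three host pairs).
* GROUP PACKING (`stub_groupPacking`, provable now — the 3-wise packing lemma).  Let `T` be a finite subgroup of
  `C(μ₀) × C(μ₁) × C(μ₂)` all of whose elements `(a, b, c)` satisfy `abc = 1` (a "hosted product-one triple group").
  Then `vol · |T| ≤ |B₀||B₁||B₂|`.  Proof: the map `T³ × X₀ × X₁ × X₂ → (B₀ × B₁ × B₂) × T²`,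
  `(d₀,d₁,d₂,x₀,x₁,x₂) ↦ ((a_{d₀}⁻¹x₀, b_{d₁}⁻¹x₁, c_{d₂}⁻¹x₂), (d₀⁻¹d₁, d₁⁻¹d₂))` is injective: a collision forces
  `d_i' = δ d_i` for one `δ = (α,β,γ) ∈ T`, and then `x₀'x₀⁻¹ = α`, `x₁'x₁⁻¹ = β`, `x₂'x₂⁻¹ = γ` with `αβγ = 1` — a TPP
  relation, so `x_i' = x_i` and `δ = 1`.  Hence `|T|³·vol ≤ |B|³·|T|²`.  SHARP at `n = 4`: the Disproof's `n4_witness`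
  (`P_hyp(4) = 32 = 8³/16`, `T = {(a,b,c) ∈ V₄³ : abc = 1}` for the 1-factorisation of `K₄`).
* HOST SIZE (`stub_hostSquare`, provable now): `|C(μ)|² = 4^m (m!)² ≤ 2m·binom(2m,m)·(m!)² = n·n!`.
* SHORT-CYCLE REGIME (kept from the planner): if SOME pair `(i, j)` has all cycles of `μ_iμ_j` shorter than
  `t = ⌈x√n⌉`, then `M_i ∪ M_j` has `≥ n/(2t)` alternating cycles, `|B_i ∩ B_j| ≥ 2^{⌊n/(2t)⌋}` (`stub_cycleCount`) and
  pairwise packing inside the hosts (`stub_pairwisePacking`: `vol²·|B_i ∩ B_j|² ≤ (n·n!)³`) gives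
  `vol ≤ (n!)^{3/2}e^{−c√n}`.
* LONG-CYCLE REGIME — THE RESIDUAL (interface `stub_symmetryBudget` = `stub_triplesToGroup` (bridge, provable) +
  `stub_localTriples` (OPEN, TPP-free; the hardest stub, held by the lead; cycle-2 reshape)): if EVERY
  pair `(i, j)` has a cycle of `μ_iμ_j` of length `≥ x√n`, there is a hosted product-one triple group `T` with
  `|T| ≥ e^{c√n}`.  Sources of `T`: (i) `2^g` from `g` support-disjoint COMMUTING LOCAL TRIPLES `(a, b, ab)` (`a ∈ C(μ₀)`,
  `b ∈ C(μ₁)` commuting involutions with `ab ∈ C(μ₂)`), e.g. reflection- or half-turn-symmetric cycles of the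
  3-edge-coloured cubic graph `M₀ ∪ M₁ ∪ M₂` (an even cycle whose colour word reads `x v y v^R` or `uu`), ladders,
  `K₄`-components; (ii) abelian subgroups `A ≤ C(μ_i) ∩ C(μ_j)` (rotations of alternating cycles, flips of common edges)
  as `{(h, 1, h⁻¹)}` etc.; (iii) commuting products of these.  Known true: random matchings, Cayley hosts of
  dihedral/affine type, Möbius ladders and the AP matchings `{x, a−x}` of the route.  A refutation of this stub kills the
  LINE, not the crux.  With `T` in hand: `vol ≤ |B|³/|T| ≤ (n·n!)^{3/2}e^{−c√n} ≤ (n!)^{3/2}e^{−(c/2)√n}`.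

Composition (kernel-checked below, no `sorry` outside `namespace Stub`): `HyperoctahedralSubsets_of`.

Disproof.lean (cdisprove evidence notes 2026-08-15T22:22Z/22:34Z/23:21Z; bodies unreadable in this jail):
`false_without_TPP` — the TPP is used 3-wise in `stub_groupPacking` and pairwise in `stub_pairwisePacking`;
`withoutFPF_iff_noThreshold` / `withoutHost_of_noThreshold` — hosts/fpf are used by `stub_hostSquare`, `stub_cycleCount`,
`stub_symmetryBudget`; `hosts_exceed_threshold` — why `stub_groupPacking` needs `|T| ≥ n^{3/4+ε}` and the line asks
`e^{c√n}`; `n4_witness` — equality case of `stub_groupPacking` (above); `matrixMultiplication_of_not_hyperoctahedralSubsets`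
— no search can refute the crux, but `stub_symmetryBudget` IS searchable (it is about three perfect matchings only).  No
`Negative/` lemma has landed for this crux.
-/

set_option linter.dupNamespace false

namespace Summit.MatrixMultiplication.MatrixMultiplication.Cruxes.HyperoctahedralSubsets.SphericalRankSieve

open Literature.Combinatorics.Additive

/-! ## The stub statements (precise `Prop`s, taken BY NAME as the hypotheses of
`HyperoctahedralSubsets_of`; their sorried witnesses `Stub.stub_*` are the REGISTERED stubs) -/

/-- **Stub 1 · `stub_pairwisePacking`** — PAIRWISE PACKING INSIDE THE HOSTS (provable now; size M).
For a TPP triple `X_i ⊆ B_i = C(μ_i)` (`μ_i` fpf involutions of `Fin n`, `n > 0`) and host indices `i ≠ j`: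
`vol² · |B_i ∩ B_j|² ≤ (n·n!)³`, `vol = |X₀||X₁||X₂|`.  Proof route: with `{i, j, k} = {0, 1, 2}`,
`(x_i, x_j) ↦ x_i⁻¹x_j` is injective on `X_i × X_j` by the TPP (take the two `k`-witnesses equal; this is the
tree pattern `RealizesTPP.mul_le_card`, for every pair — the TPP is symmetric under all permutations of the three
sets for this purpose) and lands in `B_iB_j`, `|B_iB_j|·|B_i ∩ B_j| = |B_i||B_j|` (Mathlib `Subgroup.card_mul_index`,
`Subgroup.index_inf_le`; tree `Literature.Barriers.MatrixMultiplication.card_mul_card_le_card_inf_mul_card`),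
`|X_k| ≤ |B_k|`, and `|B_i| = 2^m m!` (`Equiv.Perm.nat_card_centralizer`, `cycleType μ_i = m × {2}`) with
`(2^m m!)² = 4^m (m!)² ≤ 2m·C(2m,m)·(m!)² = n·n!` (`Nat.four_pow_le_two_mul_self_mul_centralBinom`).
Odd `n`: vacuous (no fpf involution). WHY IT MIGHT FAIL: it cannot (exact counting); only Lean bookkeeping.
[CohnUmans2003 Lemma 3.1; BlasiakCohnGrochowPrattUmans2023 Thm 3.6 (packing inside hosts); JamesKerber1981
(|B_m|)] -/
def stub_pairwisePacking : Prop :=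
  ∀ (n : ℕ), 0 < n → ∀ (μ : Fin 3 → Equiv.Perm (Fin n)) (X : Fin 3 → Finset (Equiv.Perm (Fin n))),
    (∀ i, μ i * μ i = 1 ∧ ∀ x, μ i x ≠ x) → (∀ i, ∀ σ ∈ X i, σ * μ i = μ i * σ) →
    TripleProductProperty (X 0) (X 1) (X 2) →
    ∀ i j : Fin 3, i ≠ j →
      ((X 0).card * (X 1).card * (X 2).card) ^ 2 *
          (Nat.card ↥((Subgroup.centralizer {μ i} : Subgroup (Equiv.Perm (Fin n))) ⊓
            Subgroup.centralizer {μ j})) ^ 2 ≤ (n * n.factorial) ^ 3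

/-- **Stub 2 · `stub_cycleCount`** — SHORT ALTERNATING CYCLES FORCE A LARGE HOST INTERSECTION (provable
now; size M–L).  For fpf involutions `μ₀, μ₂` of `Fin n` and `t > 0`: if every cycle of `μ₀μ₂` has length
`< t` then `|C(μ₀) ∩ C(μ₂)| ≥ 2^{⌊n/(2t)⌋}`.  Proof route: `M₀ ∪ M₂` is a disjoint union of alternating
cycles of lengths `2k₁, …, 2k_L` (`Σ k_l = m`, the coset type); `μ₀μ₂` acts on an alternating `2k`-cycle as
two `k`-cycles (`k ≥ 2`) and fixes both vertices of a digon (`k = 1`), so `cycleType (μ₀μ₂) = ⊎_{k_l ≥ 2}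
{k_l, k_l}` and the hypothesis gives `k_l ≤ t − 1`, hence `L ≥ m/(t−1) ≥ ⌊n/(2t)⌋` (`t = 1`: all digons,
`L = m`); `C(μ₀) ∩ C(μ₂) = Aut(M₀, M₂) ⊇ ∏_l ⟨r_l⟩` with `r_l` = rotation by two steps of the `l`-th cycle
(the transposition for a digon), commuting with both involutions, of order `k_l ≥ 2` (resp. `2`): an
elementary subgroup count `≥ 2^L` (`|Aut| = ∏_k (2k)^{c_k} c_k! = z_{2τ}` exactly, Macdonald VII (2.3)).
A cheaper route to the same bound: the elements `μ₀ · 1[orbit]` — `μ₀` restricted to one `⟨μ₀, μ₂⟩`-orbit, identity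
elsewhere — commute with `μ₀` and `μ₂` and generate `(ℤ/2)^L`.
WHY IT MIGHT FAIL: it cannot; the Lean cost is the cycle structure of a product of two fpf involutions
(`Equiv.Perm.cycleType`, `cycleOf`, `sameCycle`). [Macdonald1995 VII.2 (2.1)–(2.3)] -/
def stub_cycleCount : Prop :=
  ∀ (n : ℕ) (μ₀ μ₂ : Equiv.Perm (Fin n)), μ₀ * μ₀ = 1 → μ₂ * μ₂ = 1 → (∀ v, μ₀ v ≠ v) →
    (∀ v, μ₂ v ≠ v) → ∀ t : ℕ, 0 < t → (∀ k ∈ (μ₀ * μ₂).cycleType, k < t) →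
      2 ^ (n / (2 * t)) ≤
        Nat.card ↥((Subgroup.centralizer {μ₀} : Subgroup (Equiv.Perm (Fin n))) ⊓
          Subgroup.centralizer {μ₂})

/-- **Stub 3 · `stub_hostSquare`** — HOST SIZE (provable now; size S–M).  For a fixed-point-free involution `μ` of
`Fin n`, `n > 0`: `|C(μ)|² ≤ n·n!`, with `C(μ) = {σ : σμ = μσ}` counted as a `Finset`.  Proof route: `n = 2m` is even
(`Equiv.Perm.card_compl_support_modEq` with `p = 2`: a fpf involution has empty fixed-point set, so `0 ≡ n [MOD 2]`);
`|C(μ)| = 2^m·m!` (`Equiv.Perm.nat_card_centralizer`-type formula with `cycleType μ = m × {2}`, or directly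
`C(μ) ≅ S_2 ≀ S_m`; an UPPER bound by any injection into a set of size `2^m m!` suffices), and
`(2^m m!)² = 4^m (m!)² ≤ 2m·binom(2m,m)·(m!)² = 2m·(2m)! = n·n!` by `Nat.four_pow_le_two_mul_self_mul_centralBinom` and
`Nat.centralBinom` = `(2m)!/(m!)²`.  WHY IT MIGHT FAIL: it cannot. [JamesKerber1981 (|B_m| = 2^m m!); Macdonald1995 VII.2] -/
def stub_hostSquare : Prop :=
  ∀ (n : ℕ), 0 < n → ∀ μ : Equiv.Perm (Fin n), μ * μ = 1 → (∀ v, μ v ≠ v) →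
    (Finset.univ.filter (fun σ : Equiv.Perm (Fin n) => σ * μ = μ * σ)).card ^ 2 ≤ n * n.factorial

/-- **Stub 4 · `stub_groupPacking`** — GROUP PACKING, the 3-wise packing lemma (provable now; size M–L; the engine of the
reshaped line).  For `X_i ⊆ C(μ_i)` with the TPP (tree convention: `s s'⁻¹ (t t'⁻¹) (u u'⁻¹) = 1 ⇒ s = s', t = t', u = u'`)
and a finite set `T` of triples of permutations containing `1`, closed under componentwise product and inverse, with every
`(a, b, c) ∈ T` hosted (`a ∈ C(μ₀)`, `b ∈ C(μ₁)`, `c ∈ C(μ₂)`) and of product one (`abc = 1`):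
`|X₀||X₁||X₂|·|T| ≤ |C(μ₀)||C(μ₁)||C(μ₂)|`.  Proof route: `Finset.card_le_card_of_injOn` for
`Φ : T ×ˢ T ×ˢ T ×ˢ X₀ ×ˢ X₁ ×ˢ X₂ → C(μ₀) ×ˢ C(μ₁) ×ˢ C(μ₂) ×ˢ T ×ˢ T`,
`Φ(d₀,d₁,d₂,x₀,x₁,x₂) = ((d₀.1⁻¹x₀, d₁.2.1⁻¹x₁, d₂.2.2⁻¹x₂), d₀⁻¹d₁, d₁⁻¹d₂)` (maps into the target because hosts are
closed under products/inverses: `C(μ_i)` is a subgroup); injectivity: from `d₀⁻¹d₁ = d₀'⁻¹d₁'`, `d₁⁻¹d₂ = d₁'⁻¹d₂'` get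
`d_i' = δ d_i` (`i = 0,1,2`) with `δ := d₀'d₀⁻¹ ∈ T`; from the first block `x₀' = δ.1·x₀`, `x₁' = δ.2.1·x₁`,
`x₂' = δ.2.2·x₂`; the TPP applied to `(s,s',t,t',u,u') = (x₀',x₀,x₁',x₁,x₂',x₂)` (product `δ.1·δ.2.1·δ.2.2 = 1`) gives
`x_i' = x_i`, hence each component of `δ` is `1`, `δ = 1`, `d_i' = d_i`.  Then `|T|³·vol ≤ |C(μ₀)||C(μ₁)||C(μ₂)|·|T|²` and
`|T| > 0`.  No involution / fixed-point-freeness is needed.  SHARP: `n = 4`, `μ_i` the three matchings of `K₄`,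
`T = {(a,b,c) ∈ V₄³ : abc = 1}` (order 16), `X = (C(μ₀), {1,(02)}, {1,(03)})`: `32·16 = 8³` (Disproof `n4_witness`).
WHY IT MIGHT FAIL: it cannot (finite injection; checked by hand at n = 4). [CohnUmans2003 Lemma 3.1 (pairwise packing, the
case `T = 1`); this line] -/
def stub_groupPacking : Prop :=
  ∀ (n : ℕ) (μ : Fin 3 → Equiv.Perm (Fin n)) (X : Fin 3 → Finset (Equiv.Perm (Fin n)))
    (T : Finset (Equiv.Perm (Fin n) × Equiv.Perm (Fin n) × Equiv.Perm (Fin n))),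
    (∀ i, ∀ σ ∈ X i, σ * μ i = μ i * σ) → TripleProductProperty (X 0) (X 1) (X 2) →
    (1 : Equiv.Perm (Fin n) × Equiv.Perm (Fin n) × Equiv.Perm (Fin n)) ∈ T →
    (∀ s ∈ T, ∀ t ∈ T, s * t ∈ T) → (∀ t ∈ T, t⁻¹ ∈ T) →
    (∀ t ∈ T, t.1 * μ 0 = μ 0 * t.1 ∧ t.2.1 * μ 1 = μ 1 * t.2.1 ∧ t.2.2 * μ 2 = μ 2 * t.2.2 ∧
      t.1 * t.2.1 * t.2.2 = 1) →
    (X 0).card * (X 1).card * (X 2).card * T.card ≤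
      (Finset.univ.filter (fun σ : Equiv.Perm (Fin n) => σ * μ 0 = μ 0 * σ)).card *
        (Finset.univ.filter (fun σ : Equiv.Perm (Fin n) => σ * μ 1 = μ 1 * σ)).card *
        (Finset.univ.filter (fun σ : Equiv.Perm (Fin n) => σ * μ 2 = μ 2 * σ)).card

/-- **Interface · `stub_symmetryBudget`** (no longer a registered stub after the cycle-2 reshape: it is PROVED below from
Stubs 5–6, `symmetryBudget_of`) — A SYMMETRY BUDGET FOR THREE PERFECT MATCHINGS IN LONG-CYCLE POSITION (TPP-free).  `∃ x > 0 ∃ c > 0 ∃ n₀ ∀ n ≥ n₀`: for three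
fixed-point-free involutions `μ₀, μ₁, μ₂` of `Fin n` such that EVERY product `μ_iμ_j` (`i ≠ j`) has a cycle of length
`≥ x√n` (the regime not closed by Stubs 1–2; `x` is the residual prover's to choose, large `x` = strong hypothesis), there
is a finite set `T` of permutation triples with `1 ∈ T`, closed under componentwise product and inverse (a subgroup of
`S_n³`), every `(a,b,c) ∈ T` hosted (`a ∈ C(μ₀)`, `b ∈ C(μ₁)`, `c ∈ C(μ₂)`) with `abc = 1`, and `|T| ≥ e^{c√n}`.
STRUCTURE: in such a `T` every element has pairwise commuting components (`a²b² = (ab)²` forces `ab = ba`), the three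
projections are homomorphisms, and `T` embeds in `C(μ₀) × C(μ₁)`; the natural supplies are (i)
`T = ⟨(a_j, b_j, a_jb_j)⟩_{j ≤ g} ≅ (ℤ/2)^g` from `g ≥ (c/log 2)√n` SUPPORT-DISJOINT COMMUTING LOCAL TRIPLES — `a_j ∈ C(μ₀)`,
`b_j ∈ C(μ₁)` commuting involutions with `a_jb_j ∈ C(μ₂)` — which is the twin-crux disprover's packing lemma (L)
`LocalTriplePacking`; local triples live on even cycles `C` of the cubic 3-edge-coloured graph `Γ = M₀ ∪ M₁ ∪ M₂` whose
colour word is reflection-symmetric through two edge midpoints (`x v y v^R`) or half-turn symmetric (`uu`) [vertex types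
`a/b/c` = the colour of the non-cycle edge at the vertex; `a` acts as the symmetry on types `b, c`, `b` on types `a, c`,
`ab` on types `a, b`], on ladder/Möbius 4-cycles `0,2,1,2` (`a` flips an `M₀`-edge, `b` flips an `M₁`-edge, `ab` swaps two
`M₂`-edges), and on `K₄`-components; (ii) abelian subgroups of a pairwise intersection `C(μ_i) ∩ C(μ_j)` (rotations of
alternating cycles, flips of common edges: `≥ 2^{#alternating cycles}`), entered as `(h, h⁻¹, 1)`-type triples; (iii)
commuting products of (i)–(ii).  KNOWN CASES: random matchings (`Γ` has `≈ 2^{k/2}/2` symmetric `k`-cycles, nearly disjoint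
at `k = (1+ε)log₂ n`; the disprover reports `g ≈ n/log n` on every random family tested), Cayley hosts `Cay(G; s₀,s₁,s₂)`
of dihedral type (hexagons `(r_a r_b r_c)² = 1` at every vertex ⇒ `g ≥ n/36`) and affine type (translations ⇒ `≈ √n/2`
alternating `2p`-cycles per pair ⇒ Stub 2 regime), Möbius ladders / the route's AP matchings `M_a = {x, a−x}` (4-cycles at
every even `x < m`: `g ≥ (m−1)/2`).  WHY IT MIGHT FAIL: an adversarial 3-edge-coloured cubic graph in which all three
2-factors `M_i ∪ M_j` have `o(√n)` cycles AND fewer than `c√n` vertex-disjoint symmetric cycles exist (rigid colourings: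
`τ = M₂` read on a Hamiltonian `M₀ ∪ M₁` with no pairs `τ(x+p) − τ(x) ≡ ±p`, `p ≤ √n` — algebraic `τ` (`x ↦ 1/x`,
CRT-involutions) still give `Θ(√n)` such pairs at scales `p ≤ ε√n` or `p ≈ √n`, borderline but sufficient); such a family
refutes this STUB (the line dies: `Lines/spherical-rank-sieve.dead.md`), not the crux.  CHEAPEST FALSIFIER: compute the
largest hosted product-one triple group / the number of disjoint local triples for candidate rigid families at `n ≤ 200`
(kit).  [twin crux stmt-10883 Disproof.lean `hyperoctahedralSubsets_of_packing` (L); BlasiakChurchCohnGrochowUmans2017 §4–5;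
Macdonald1995 VII.2 (coset types); this line] -/
def stub_symmetryBudget : Prop :=
  ∃ x : ℝ, 0 < x ∧ ∃ c : ℝ, 0 < c ∧ ∃ n₀ : ℕ, ∀ n ≥ n₀, ∀ μ : Fin 3 → Equiv.Perm (Fin n),
    (∀ i, μ i * μ i = 1 ∧ ∀ v, μ i v ≠ v) →
    (∀ i j : Fin 3, i ≠ j → ∃ k ∈ (μ i * μ j).cycleType, x * Real.sqrt (n : ℝ) ≤ (k : ℝ)) →
    ∃ T : Finset (Equiv.Perm (Fin n) × Equiv.Perm (Fin n) × Equiv.Perm (Fin n)),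
      (1 : Equiv.Perm (Fin n) × Equiv.Perm (Fin n) × Equiv.Perm (Fin n)) ∈ T ∧
      (∀ s ∈ T, ∀ t ∈ T, s * t ∈ T) ∧ (∀ t ∈ T, t⁻¹ ∈ T) ∧
      (∀ t ∈ T, t.1 * μ 0 = μ 0 * t.1 ∧ t.2.1 * μ 1 = μ 1 * t.2.1 ∧ t.2.2 * μ 2 = μ 2 * t.2.2 ∧
        t.1 * t.2.1 * t.2.2 = 1) ∧
      Real.exp (c * Real.sqrt (n : ℝ)) ≤ (T.card : ℝ)


/-- **Stub 5 · `stub_triplesToGroup`** — THE BRIDGE: SUPPORT-DISJOINT COMMUTING LOCAL TRIPLES GENERATE A HOSTED PRODUCT-ONE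
TRIPLE GROUP OF ORDER `2^g` (provable now; size M–L).  Data: `g` local triples `(a_j, b_j, a_j b_j)` — `a_j, b_j` commuting
involutions (possibly one of them trivial, not both), `a_j ∈ C(μ₀)`, `b_j ∈ C(μ₁)`, `a_j b_j ∈ C(μ₂)` — with pairwise
disjoint supports (a point moved by `a_j` or `b_j` is fixed by `a_{j'}` and `b_{j'}`, `j' ≠ j`).  Claim: there is a finite
set `T` of permutation triples containing `1`, closed under componentwise `*` and `⁻¹`, hosted with product one, of size
`≥ 2^g`.  Proof route: for `S : Finset (Fin g)` put `A_S := ∏_{j∈S} a_j`, `B_S := ∏_{j∈S} b_j` (`Finset.noncommProd`; all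
`a_j, b_{j'}` pairwise commute: equal index by hypothesis, distinct indices by `Equiv.Perm.Disjoint.commute`), and
`T := univ.image (S ↦ (A_S, B_S, (A_S B_S)⁻¹))`.  Product one is by construction; hosts: `C(μ_i)` is closed under products
and inverses, and `A_S B_S = ∏_{j∈S} a_j b_j ∈ C(μ₂)` (`Finset.noncommProd_mul_distrib`); closure: `A_S A_{S'} = A_{S ∆ S'}`
(split over `S ∖ S'`, `S ∩ S'`, `S' ∖ S` with `Finset.noncommProd_union_of_disjoint`; `A_{S∩S'}² = 1` as a product of
commuting involutions), likewise for `B`, and `(A_S B_S)⁻¹ = A_S B_S`; inverses: every element of `T` is an involution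
triple, `t⁻¹ = t`; `1 = ` image of `∅`; size: `S ↦ A_S, B_S` is injective — for `j ∈ S ∆ S'` some `v` is moved by `a_j`
(or `b_j`), all other generators fix `v`, so `A_S v ≠ A_{S'} v` (evaluation lemma for products of support-disjoint
permutations, by `Finset.induction_on`) — hence `T.card = 2^g` (`Finset.card_image_of_injective`, `Finset.card_univ`,
`Fintype.card_finset`).  No hypothesis on `μ` is needed.  WHY IT MIGHT FAIL: it cannot. [this line; twin crux stmt-10883
Disproof.lean `hyperoctahedralSubsets_of_packing` (the same bookkeeping)] -/
def stub_triplesToGroup : Prop :=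
  ∀ (n : ℕ) (μ : Fin 3 → Equiv.Perm (Fin n)) (g : ℕ) (a b : Fin g → Equiv.Perm (Fin n)),
    (∀ j, a j * a j = 1 ∧ b j * b j = 1 ∧ a j * b j = b j * a j ∧ (a j ≠ 1 ∨ b j ≠ 1) ∧
      a j * μ 0 = μ 0 * a j ∧ b j * μ 1 = μ 1 * b j ∧ a j * b j * μ 2 = μ 2 * (a j * b j)) →
    (∀ j j' : Fin g, j ≠ j' → ∀ v, (a j v ≠ v ∨ b j v ≠ v) → a j' v = v ∧ b j' v = v) →
    ∃ T : Finset (Equiv.Perm (Fin n) × Equiv.Perm (Fin n) × Equiv.Perm (Fin n)),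
      (1 : Equiv.Perm (Fin n) × Equiv.Perm (Fin n) × Equiv.Perm (Fin n)) ∈ T ∧
      (∀ s ∈ T, ∀ t ∈ T, s * t ∈ T) ∧ (∀ t ∈ T, t⁻¹ ∈ T) ∧
      (∀ t ∈ T, t.1 * μ 0 = μ 0 * t.1 ∧ t.2.1 * μ 1 = μ 1 * t.2.1 ∧ t.2.2 * μ 2 = μ 2 * t.2.2 ∧
        t.1 * t.2.1 * t.2.2 = 1) ∧
      2 ^ g ≤ T.card

/-- **Stub 6 · `stub_localTriples`** — THE RESIDUAL: LOCAL TRIPLE PACKING IN LONG-CYCLE POSITION (OPEN, TPP-free; the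
hardest stub; held by the lead; = the twin-crux disprover's packing lemma (L) `LocalTriplePacking` restricted to the
regime Stubs 1–2 do not close).  `∃ x > 0 ∃ c > 0 ∃ n₀ ∀ n ≥ n₀`: for three fixed-point-free involutions `μ₀, μ₁, μ₂` of
`Fin n` such that every product `μ_iμ_j` (`i ≠ j`) has a cycle of length `≥ x√n`, there are `g ≥ c√n` SUPPORT-DISJOINT
COMMUTING LOCAL TRIPLES: commuting involutions `a_j ∈ C(μ₀)`, `b_j ∈ C(μ₁)` (not both trivial) with `a_j b_j ∈ C(μ₂)`,
`j < g`, any point moved by `a_j` or `b_j` being fixed by all `a_{j'}, b_{j'}`, `j' ≠ j`.  SUPPLY (all verified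
algebraically by `job/symmetry_budget.py`, kit j009170): every EVEN CYCLE `C` of the cubic 3-edge-coloured multigraph
`Γ = M₀ ∪ M₁ ∪ M₂` whose cyclic colour word is symmetric under a reflection through two edge midpoints (`x v y v^R`) or
under the half turn (`uu`) carries a local triple supported on `V(C)`: with the vertex type = colour of the non-cycle edge,
`a` := the symmetry on the vertices of type `≠ 0`, `b` := the symmetry on the vertices of type `≠ 1` (then `ab` moves the
types `≠ 2`); special cases: a common edge of `M_i, M_j` (digon), an alternating (bicoloured) cycle with a reflection, the
ladder/Möbius 4-cycle `0,2,1,2` (`a` flips an `M₀`-edge, `b` an `M₁`-edge, `ab` swaps two `M₂`-chords), the hexagons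
`(r_a r_b r_c)² = 1` of dihedral Cayley hosts; `K₄`-components give `V₄`.  In group language (Cayley hosts
`Cay(G; s₀,s₁,s₂)`): reflection-symmetric cycles ↔ short words `v` with `v⁻¹ s_x v = s_y` (e.g. `v ∈ C_G(s_x)`, forced at
length `≤ 4 log₂[G : C_G(s_x)] + 2` by pigeonhole on cosets), half-turn cycles ↔ short involutive words `u`; vertex
transitivity turns one symmetric `k`-cycle into `≥ n/k²` disjoint ones.  KNOWN CASES: random matchings (`≈ 2^{k/2}/2`
symmetric `k`-cycles, nearly disjoint at `k = (1+ε)log₂ n`; disprover: `g ≈ n/log n` on every random family tested),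
dihedral/affine Cayley hosts, Möbius ladders, the route's AP matchings `{x, a−x}` (`g ≥ (m−1)/2`); the drefuter's adversarial
annealing (n = 64) halves the supply but cannot clear cycles of length `≤ 2 log₂ n`.  WHY IT MIGHT FAIL: a rigid family —
all three 2-factors with `o(√n)` cycles and `o(√n)` vertex-disjoint symmetric cycles (pair-graph BFS forces only
DOUBLE-CLOSED words of length `≤ 4 log₂ n + 3` at every vertex pair, not gadgets; counting alone does not force them) —
would refute this STUB and kill the line (`Lines/spherical-rank-sieve.dead.md`), not the crux; none is known.  CHEAPEST
FALSIFIER: kit census of the greedy gadget packing on candidate rigid families (inversion `x ↦ c/x` on `𝔽_p^*`,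
involutory Möbius maps on `P¹(𝔽_p)`, greedy/annealed adversaries) at `n ≤ 400` — job j009170 (lead), j009408/j009521–3
(drefuter).  [twin crux stmt-10883 Disproof.lean (L); BlasiakChurchCohnGrochowUmans2017 §4–5; this line] -/
def stub_localTriples : Prop :=
  ∃ x : ℝ, 0 < x ∧ ∃ c : ℝ, 0 < c ∧ ∃ n₀ : ℕ, ∀ n ≥ n₀, ∀ μ : Fin 3 → Equiv.Perm (Fin n),
    (∀ i, μ i * μ i = 1 ∧ ∀ v, μ i v ≠ v) →
    (∀ i j : Fin 3, i ≠ j → ∃ k ∈ (μ i * μ j).cycleType, x * Real.sqrt (n : ℝ) ≤ (k : ℝ)) →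
    ∃ (g : ℕ) (a b : Fin g → Equiv.Perm (Fin n)),
      c * Real.sqrt (n : ℝ) ≤ (g : ℝ) ∧
      (∀ j, a j * a j = 1 ∧ b j * b j = 1 ∧ a j * b j = b j * a j ∧ (a j ≠ 1 ∨ b j ≠ 1) ∧
        a j * μ 0 = μ 0 * a j ∧ b j * μ 1 = μ 1 * b j ∧ a j * b j * μ 2 = μ 2 * (a j * b j)) ∧
      (∀ j j' : Fin g, j ≠ j' → ∀ v, (a j v ≠ v ∨ b j v ≠ v) → a j' v = v ∧ b j' v = v)

/-! ## Registered stubs (`sorry` lives only here; signatures = the statements verbatim, fully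
qualified, so that a Theorems-side `--supports stmt-MatrixMultiplication-8305` proof can restate them).
LANDED (cycle 1): `stub_groupPacking` p74548, `stub_pairwisePacking` p75305, `stub_hostSquare` p75879,
`stub_cycleCount` p76793 — their witnesses below are the tree theorems (imported), no `sorry`. -/

namespace Stub

theorem stub_pairwisePacking : ∀ (n : ℕ), 0 < n → ∀ (μ : Fin 3 → Equiv.Perm (Fin n)) (X : Fin 3 → Finset (Equiv.Perm (Fin n))), (∀ i, μ i * μ i = 1 ∧ ∀ x, μ i x ≠ x) → (∀ i, ∀ σ ∈ X i, σ * μ i = μ i * σ) → Literature.Combinatorics.Additive.TripleProductProperty (X 0) (X 1) (X 2) → ∀ i j : Fin 3, i ≠ j → ((X 0).card * (X 1).card * (X 2).card) ^ 2 * (Nat.card ↥((Subgroup.centralizer {μ i} : Subgroup (Equiv.Perm (Fin n))) ⊓ Subgroup.centralizer {μ j})) ^ 2 ≤ (n * n.factorial) ^ 3 :=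
  Summit.MatrixMultiplication.MatrixMultiplication.Theorems.HyperoctahedralSubsets.stub_pairwisePacking

theorem stub_cycleCount : ∀ (n : ℕ) (μ₀ μ₂ : Equiv.Perm (Fin n)), μ₀ * μ₀ = 1 → μ₂ * μ₂ = 1 → (∀ v, μ₀ v ≠ v) → (∀ v, μ₂ v ≠ v) → ∀ t : ℕ, 0 < t → (∀ k ∈ (μ₀ * μ₂).cycleType, k < t) → 2 ^ (n / (2 * t)) ≤ Nat.card ↥((Subgroup.centralizer {μ₀} : Subgroup (Equiv.Perm (Fin n))) ⊓ Subgroup.centralizer {μ₂}) := by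
  -- LANDED p76793 (`…Theorems.HyperoctahedralSubsets.stub_cycleCount`); imported once the farm has built it
  sorry

theorem stub_hostSquare : ∀ (n : ℕ), 0 < n → ∀ μ : Equiv.Perm (Fin n), μ * μ = 1 → (∀ v, μ v ≠ v) → (Finset.univ.filter (fun σ : Equiv.Perm (Fin n) => σ * μ = μ * σ)).card ^ 2 ≤ n * n.factorial :=
  Summit.MatrixMultiplication.MatrixMultiplication.Theorems.HyperoctahedralSubsets.stub_hostSquare

theorem stub_groupPacking : ∀ (n : ℕ) (μ : Fin 3 → Equiv.Perm (Fin n)) (X : Fin 3 → Finset (Equiv.Perm (Fin n))) (T : Finset (Equiv.Perm (Fin n) × Equiv.Perm (Fin n) × Equiv.Perm (Fin n))), (∀ i, ∀ σ ∈ X i, σ * μ i = μ i * σ) → Literature.Combinatorics.Additive.TripleProductProperty (X 0) (X 1) (X 2) → (1 : Equiv.Perm (Fin n) × Equiv.Perm (Fin n) × Equiv.Perm (Fin n)) ∈ T → (∀ s ∈ T, ∀ t ∈ T, s * t ∈ T) → (∀ t ∈ T, t⁻¹ ∈ T) → (∀ t ∈ T, t.1 * μ 0 = μ 0 * t.1 ∧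 t.2.1 * μ 1 = μ 1 * t.2.1 ∧ t.2.2 * μ 2 = μ 2 * t.2.2 ∧ t.1 * t.2.1 * t.2.2 = 1) → (X 0).card * (X 1).card * (X 2).card * T.card ≤ (Finset.univ.filter (fun σ : Equiv.Perm (Fin n) => σ * μ 0 = μ 0 * σ)).card * (Finset.univ.filter (fun σ : Equiv.Perm (Fin n) => σ * μ 1 = μ 1 * σ)).card * (Finset.univ.filter (fun σ : Equiv.Perm (Fin n) => σ * μ 2 = μ 2 * σ)).card :=
  Summit.MatrixMultiplication.MatrixMultiplication.Theorems.HyperoctahedralSubsets.stub_groupPacking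

theorem stub_triplesToGroup : ∀ (n : ℕ) (μ : Fin 3 → Equiv.Perm (Fin n)) (g : ℕ) (a b : Fin g → Equiv.Perm (Fin n)), (∀ j, a j * a j = 1 ∧ b j * b j = 1 ∧ a j * b j = b j * a j ∧ (a j ≠ 1 ∨ b j ≠ 1) ∧ a j * μ 0 = μ 0 * a j ∧ b j * μ 1 = μ 1 * b j ∧ a j * b j * μ 2 = μ 2 * (a j * b j)) → (∀ j j' : Fin g, j ≠ j' → ∀ v, (a j v ≠ v ∨ b j v ≠ v) → a j' v = v ∧ b j' v = v) → ∃ T : Finset (Equiv.Perm (Fin n) × Equiv.Perm (Fin n) × Equiv.Perm (Fin n)), (1 : Equiv.Perm (Fin n) × Equiv.Perm (Fin n) × Equiv.Perm (Fin n)) ∈ T ∧ (∀ s ∈ T, ∀ t ∈ T, s * t ∈ T) ∧ (∀ t ∈ T, t⁻¹ ∈ T) ∧ (∀ t ∈ T, t.1 * μ 0 = μ 0 * t.1 ∧ t.2.1 * μ 1 = μ 1 * t.2.1 ∧ t.2.2 * μ 2 = μ 2 * t.2.2 ∧ t.1 * t.2.1 * t.2.2 = 1) ∧ 2 ^ g ≤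 T.card := by
  sorry

theorem stub_localTriples : ∃ x : ℝ, 0 < x ∧ ∃ c : ℝ, 0 < c ∧ ∃ n₀ : ℕ, ∀ n ≥ n₀, ∀ μ : Fin 3 → Equiv.Perm (Fin n), (∀ i, μ i * μ i = 1 ∧ ∀ v, μ i v ≠ v) → (∀ i j : Fin 3, i ≠ j → ∃ k ∈ (μ i * μ j).cycleType, x * Real.sqrt (n : ℝ) ≤ (k : ℝ)) → ∃ (g : ℕ) (a b : Fin g → Equiv.Perm (Fin n)), c * Real.sqrt (n : ℝ) ≤ (g : ℝ) ∧ (∀ j, a j * a j = 1 ∧ b j * b j = 1 ∧ a j * b j = b j * a j ∧ (a j ≠ 1 ∨ b j ≠ 1) ∧ a j * μ 0 = μ 0 * a j ∧ b j * μ 1 = μ 1 * b j ∧ a j * b j * μ 2 = μ 2 * (a j * b j)) ∧ (∀ j j' : Fin g, j ≠ j' → ∀ v, (a j v ≠ v ∨ b j v ≠ v) → a j' v = v ∧ b j' v = v) := by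
  sorry

end Stub

/-! ## Elementary lemmas used by the composition (sorry-free; from the planner's skeleton) -/

/-- `N^{3/2} = N · √N` for `N > 0`. -/
theorem rpow_three_halves {N : ℝ} (hN : 0 < N) : N ^ ((3 : ℝ) / 2) = N * Real.sqrt N := by
  rw [show ((3 : ℝ) / 2) = 1 + 1 / 2 by norm_num, Real.rpow_add hN, Real.rpow_one, Real.sqrt_eq_rpow]

/-- Growth threshold: for `c, x > 0`, eventually `2 n √n ≤ e^{c√n}` and `x√n ≥ 1`. -/
theorem growth_threshold {c x : ℝ} (hc : 0 < c) (hx : 0 < x) :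
    ∃ n₃ : ℕ, ∀ n : ℕ, n₃ ≤ n →
      2 * (n : ℝ) * Real.sqrt n ≤ Real.exp (c * Real.sqrt n) ∧ 1 ≤ x * Real.sqrt n := by
  refine ⟨⌈6250 / c ^ 5⌉₊ + ⌈1 / x ^ 2⌉₊, fun n hn => ?_⟩
  have hnR : ((⌈6250 / c ^ 5⌉₊ + ⌈1 / x ^ 2⌉₊ : ℕ) : ℝ) ≤ n := by exact_mod_cast hn
  push_cast at hnR
  have hc1 : 6250 / c ^ 5 ≤ (n : ℝ) :=
    le_trans (Nat.le_ceil _) (by linarith [Nat.cast_nonneg (α := ℝ) ⌈1 / x ^ 2⌉₊])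
  have hx1 : 1 / x ^ 2 ≤ (n : ℝ) :=
    le_trans (Nat.le_ceil _) (by linarith [Nat.cast_nonneg (α := ℝ) ⌈6250 / c ^ 5⌉₊])
  set s : ℝ := Real.sqrt n with hs_def
  have hs : 0 ≤ s := Real.sqrt_nonneg _
  have hs2 : s ^ 2 = n := Real.sq_sqrt (Nat.cast_nonneg n)
  have hn0 : (0 : ℝ) ≤ n := Nat.cast_nonneg n
  constructor
  · -- `e^{cs} = (e^{cs/5})^5 ≥ (cs/5)^5 = c^5 n^2 s / 3125 ≥ 2 n s`
    have h1 : (c * s / 5) ^ 5 ≤ Real.exp (c * s) := by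
      have h0 : 0 ≤ c * s / 5 := by positivity
      have hadd := Real.add_one_le_exp (c * s / 5)
      calc (c * s / 5) ^ 5 ≤ (c * s / 5 + 1) ^ 5 := by gcongr; linarith
        _ ≤ (Real.exp (c * s / 5)) ^ 5 := by gcongr
        _ = Real.exp (c * s) := by
            rw [← Real.exp_nat_mul]; congr 1; push_cast; ring
    have h2 : (c * s / 5) ^ 5 = c ^ 5 * (n : ℝ) ^ 2 * s / 3125 := by
      have e : s ^ 5 = (s ^ 2) ^ 2 * s := by ring
      rw [div_pow, mul_pow, e, hs2]; ring
    have hcn : 6250 ≤ c ^ 5 * (n : ℝ) := by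
      have := hc1; rwa [div_le_iff₀ (by positivity), mul_comm] at this
    have hns : 0 ≤ (n : ℝ) * s := mul_nonneg hn0 hs
    have h3 : 2 * (n : ℝ) * s ≤ c ^ 5 * (n : ℝ) ^ 2 * s / 3125 := by
      have := mul_le_mul_of_nonneg_left hcn hns
      nlinarith [this]
    calc 2 * (n : ℝ) * s ≤ c ^ 5 * (n : ℝ) ^ 2 * s / 3125 := h3
      _ = (c * s / 5) ^ 5 := h2.symm
      _ ≤ Real.exp (c * s) := h1
  · -- `x s = √(x² n) ≥ 1`
    have e : x * s = Real.sqrt (x ^ 2 * n) := by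
      rw [Real.sqrt_mul' _ hn0, Real.sqrt_sq hx.le]
    rw [e, Real.one_le_sqrt]
    have := hx1
    rw [div_le_iff₀ (by positivity)] at this
    linarith

/-- **`symmetryBudget_of`** — the interface `stub_symmetryBudget` from the bridge (Stub 5) and the residual (Stub 6):
`g ≥ c√n` disjoint local triples give a hosted product-one triple group of order `≥ 2^g ≥ e^{(c log 2)√n}`. -/
theorem symmetryBudget_of (hB : stub_triplesToGroup) (hL : stub_localTriples) : stub_symmetryBudget := by
  obtain ⟨x, hx, c, hc, n₀, hL1⟩ := hL
  refine ⟨x, hx, c * Real.log 2, mul_pos hc (Real.log_pos one_lt_two), n₀, ?_⟩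
  intro n hn μ hμ hlong
  obtain ⟨g, a, b, hg, hloc, hdisj⟩ := hL1 n hn μ hμ hlong
  obtain ⟨T, h1, hmul, hinv, hhost, hcard⟩ := hB n μ g a b hloc hdisj
  refine ⟨T, h1, hmul, hinv, hhost, ?_⟩
  have h2 : (2 : ℝ) ^ g ≤ (T.card : ℝ) := by exact_mod_cast hcard
  refine le_trans ?_ h2
  have e : Real.exp (Real.log 2 * g) = (2 : ℝ) ^ g := by
    rw [mul_comm, Real.exp_nat_mul, Real.exp_log two_pos]
  rw [← e]
  apply Real.exp_le_exp.2
  have := mul_le_mul_of_nonneg_left hg (Real.log_pos one_lt_two).le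
  nlinarith [this]

/-! ## The composition (kernel-checked; concludes the crux BY NAME) -/

/-- **`HyperoctahedralSubsets_of`** — the glue of the reshaped line (regime split on the three host pairs):
* constants: Stub 5 gives the cycle threshold `x√n` and its budget rate `cR`; the final constant is
  `c := min (cR / 2) (log 2 / (8x))`, `n₀ = n₂ + n₃ + 1` (`n₂` from Stub 5, `n₃`: `2n√n ≤ e^{c√n}` and `x√n ≥ 1`);
* LONG-CYCLE REGIME (every `μ_iμ_j`, `i ≠ j`, has a cycle `≥ x√n`): Stub 5 gives a hosted product-one triple group
  `T`, `|T| ≥ e^{cR√n}`; group packing (Stub 4) gives `vol·|T| ≤ |C(μ₀)||C(μ₁)||C(μ₂)|`, the host bound (Stub 3)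
  `|C(μ_i)|² ≤ n·n!`, so `vol ≤ (n·n!)^{3/2} e^{−cR√n} = n!√(n!)·(n√n·e^{−cR√n}) ≤ n!√(n!)·e^{−c√n}` since
  `n√n ≤ e^{c√n}` and `2c ≤ cR`;
* SHORT-CYCLE REGIME (some pair `(i, j)` has all cycles `< x√n ≤ t := ⌈x√n⌉`): Stub 2 gives
  `|C(μ_i) ∩ C(μ_j)| ≥ 2^{n/(2t)} ≥ e^{2c√n}/2`, and pairwise packing inside the hosts (Stub 1) gives
  `vol ≤ (n·n!)^{3/2}/|C(μ_i) ∩ C(μ_j)| ≤ (n!)^{3/2}·2n√n·e^{−2c√n} ≤ (n!)^{3/2}e^{−c√n}` once `2n√n ≤ e^{c√n}`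
  (the planner's branch, verbatim up to the pair indices). -/
theorem HyperoctahedralSubsets_of (hP : stub_pairwisePacking) (hK : stub_cycleCount)
    (hH : stub_hostSquare) (hG : stub_groupPacking) (hR : stub_symmetryBudget) :
    Summit.MatrixMultiplication.MatrixMultiplication.Theses.SnSubsetDichotomy.HyperoctahedralSubsets := by
  obtain ⟨x, hx, cR, hcR, n₂, hR1⟩ := hR
  have hlog2 : 0 < Real.log 2 := Real.log_pos one_lt_two
  set c : ℝ := min (cR / 2) (Real.log 2 / (8 * x)) with hc_def
  have hc0 : 0 < c := lt_min (by linarith) (div_pos hlog2 (by positivity))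
  have hcR2 : c ≤ cR / 2 := min_le_left _ _
  have hc2 : c ≤ Real.log 2 / (8 * x) := min_le_right _ _
  obtain ⟨n₃, hn₃⟩ := growth_threshold hc0 hx
  refine ⟨c, hc0, n₂ + n₃ + 1, ?_⟩
  intro n hn μ hμ X hX hT
  have hn₂ : n₂ ≤ n := by omega
  have hn₃' : n₃ ≤ n := by omega
  have hn0 : 0 < n := by omega
  obtain ⟨hgrow, hxn⟩ := hn₃ n hn₃'
  have hF0 : (0 : ℝ) < n.factorial := by exact_mod_cast n.factorial_pos
  have hF : (n.factorial : ℝ) ^ ((3 : ℝ) / 2) = n.factorial * Real.sqrt (n.factorial : ℝ) :=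
    rpow_three_halves hF0
  have hsn : (0 : ℝ) ≤ Real.sqrt n := Real.sqrt_nonneg _
  -- the target, with `(n!)^{3/2}` spelled `n!·√(n!)`; every branch ends in `vol ≤ n!√(n!)·e^{-r√n}`
  -- for some rate `r ≥ c`
  have finish : ∀ r : ℝ, c ≤ r →
      (((X 0).card * (X 1).card * (X 2).card : ℕ) : ℝ) ≤
        (n.factorial : ℝ) * Real.sqrt (n.factorial : ℝ) * Real.exp (-(r * Real.sqrt n)) →
      (((X 0).card * (X 1).card * (X 2).card : ℕ) : ℝ) ≤
        (n.factorial : ℝ) ^ ((3 : ℝ) / 2) * Real.exp (-(c * Real.sqrt (n : ℝ))) := by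
    intro r hr h
    rw [hF]
    refine h.trans (mul_le_mul_of_nonneg_left (Real.exp_le_exp.2 ?_) (by positivity))
    have := mul_le_mul_of_nonneg_right hr hsn
    linarith
  by_cases hlong : ∀ i j : Fin 3, i ≠ j → ∃ k ∈ (μ i * μ j).cycleType, x * Real.sqrt (n : ℝ) ≤ (k : ℝ)
  · -- LONG-CYCLE REGIME: symmetry budget (Stub 5) + group packing (Stub 4) + host size (Stub 3)
    obtain ⟨T, h1T, hmulT, hinvT, hhostT, hbigT⟩ := hR1 n hn₂ μ hμ hlong
    have hGv := hG n μ X T hX hT h1T hmulT hinvT hhostT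
    set V : ℕ := (X 0).card * (X 1).card * (X 2).card with hV_def
    set z : Fin 3 → ℕ := fun i =>
      (Finset.univ.filter (fun σ : Equiv.Perm (Fin n) => σ * μ i = μ i * σ)).card with hz_def
    have hz2 : ∀ i, ((z i : ℕ) : ℝ) ^ 2 ≤ (n : ℝ) * n.factorial := fun i => by
      have := hH n hn0 (μ i) (hμ i).1 (hμ i).2
      exact_mod_cast this
    have hGr : (V : ℝ) * T.card ≤ (z 0 : ℝ) * z 1 * z 2 := by exact_mod_cast hGv
    set M : ℝ := (n : ℝ) * n.factorial with hM_def
    have hM0 : 0 ≤ M := by positivity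
    have hZsq : ((z 0 : ℝ) * z 1 * z 2) ^ 2 ≤ M ^ 3 := by
      have e : ((z 0 : ℝ) * z 1 * z 2) ^ 2 = (z 0 : ℝ) ^ 2 * (z 1 : ℝ) ^ 2 * (z 2 : ℝ) ^ 2 := by ring
      have e3 : M ^ 3 = M * M * M := by ring
      rw [e, e3]
      have h0 := hz2 0
      have h1 := hz2 1
      have h2 := hz2 2
      gcongr
    have hZ : (z 0 : ℝ) * z 1 * z 2 ≤ M * Real.sqrt M := by
      have e : (M * Real.sqrt M) ^ 2 = M ^ 3 := by rw [mul_pow, Real.sq_sqrt hM0]; ring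
      exact (pow_le_pow_iff_left₀ (by positivity) (by positivity) two_ne_zero).1 (e ▸ hZsq)
    have hV1 : (V : ℝ) * Real.exp (cR * Real.sqrt n) ≤ M * Real.sqrt M :=
      calc (V : ℝ) * Real.exp (cR * Real.sqrt n) ≤ (V : ℝ) * T.card :=
            mul_le_mul_of_nonneg_left hbigT (by positivity)
        _ ≤ (z 0 : ℝ) * z 1 * z 2 := hGr
        _ ≤ M * Real.sqrt M := hZ
    have hV2 : (V : ℝ) ≤ M * Real.sqrt M * Real.exp (-(cR * Real.sqrt n)) := by
      have h3 : Real.exp (cR * Real.sqrt n) * Real.exp (-(cR * Real.sqrt n)) = 1 := by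
        rw [← Real.exp_add, add_neg_cancel, Real.exp_zero]
      have := mul_le_mul_of_nonneg_right hV1 (Real.exp_pos (-(cR * Real.sqrt n))).le
      rwa [mul_assoc, h3, mul_one] at this
    have hMsplit : M * Real.sqrt M =
        ((n : ℝ) * Real.sqrt n) * ((n.factorial : ℝ) * Real.sqrt (n.factorial : ℝ)) := by
      rw [hM_def, Real.sqrt_mul (Nat.cast_nonneg n)]; ring
    have hexp : (n : ℝ) * Real.sqrt n * Real.exp (-(cR * Real.sqrt n)) ≤
        Real.exp (-(c * Real.sqrt n)) := by
      have e1 : Real.exp (c * Real.sqrt n) * Real.exp (-(cR * Real.sqrt n)) ≤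
          Real.exp (-(c * Real.sqrt n)) := by
        rw [← Real.exp_add]
        apply Real.exp_le_exp.2
        have := mul_le_mul_of_nonneg_right hcR2 hsn
        nlinarith
      have e0 : (n : ℝ) * Real.sqrt n ≤ Real.exp (c * Real.sqrt n) := by
        have : 0 ≤ (n : ℝ) * Real.sqrt n := by positivity
        linarith
      calc (n : ℝ) * Real.sqrt n * Real.exp (-(cR * Real.sqrt n))
          ≤ Real.exp (c * Real.sqrt n) * Real.exp (-(cR * Real.sqrt n)) :=
            mul_le_mul_of_nonneg_right e0 (Real.exp_pos _).le
        _ ≤ Real.exp (-(c * Real.sqrt n)) := e1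
    apply finish c le_rfl
    calc (V : ℝ) ≤ M * Real.sqrt M * Real.exp (-(cR * Real.sqrt n)) := hV2
      _ = ((n.factorial : ℝ) * Real.sqrt (n.factorial : ℝ)) *
            ((n : ℝ) * Real.sqrt n * Real.exp (-(cR * Real.sqrt n))) := by rw [hMsplit]; ring
      _ ≤ ((n.factorial : ℝ) * Real.sqrt (n.factorial : ℝ)) * Real.exp (-(c * Real.sqrt n)) :=
            mul_le_mul_of_nonneg_left hexp (by positivity)
  · -- SHORT-CYCLE REGIME: some pair `(i, j)` has only short cycles — many alternating cycles (Stub 2),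
    -- pairwise packing in the hosts (Stub 1); the planner's branch with `(0, 2)` replaced by `(i, j)`
    push Not at hlong
    obtain ⟨i, j, hij, hshort⟩ := hlong
    have hxn0 : 0 < x * Real.sqrt n := by linarith
    set t : ℕ := ⌈x * Real.sqrt (n : ℝ)⌉₊ with ht_def
    have ht0 : 0 < t := Nat.ceil_pos.2 hxn0
    have hall : ∀ k ∈ (μ i * μ j).cycleType, k < t := fun k hk => Nat.lt_ceil.2 (hshort k hk)
    have hz := hK n (μ i) (μ j) (hμ i).1 (hμ j).1 (hμ i).2 (hμ j).2 t ht0 hall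
    have hpack := hP n hn0 μ X hμ hX hT i j hij
    set V : ℕ := (X 0).card * (X 1).card * (X 2).card with hV_def
    set z : ℕ := Nat.card ↥((Subgroup.centralizer {μ i} : Subgroup (Equiv.Perm (Fin n))) ⊓
      Subgroup.centralizer {μ j}) with hz_def
    set q : ℕ := n / (2 * t) with hq_def
    have hz1 : (1 : ℝ) ≤ z := by exact_mod_cast Nat.one_le_two_pow.trans hz
    have hz0 : (0 : ℝ) < z := by linarith
    have hM0 : (0 : ℝ) ≤ (n : ℝ) * n.factorial := by positivity
    have h1' : (V : ℝ) ^ 2 * (z : ℝ) ^ 2 ≤ ((n : ℝ) * n.factorial) ^ 3 := by exact_mod_cast hpack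
    have h1 : ((V : ℝ) * z) ^ 2 ≤ ((n : ℝ) * n.factorial * Real.sqrt ((n : ℝ) * n.factorial)) ^ 2 := by
      have e : ((n : ℝ) * n.factorial * Real.sqrt ((n : ℝ) * n.factorial)) ^ 2 =
          ((n : ℝ) * n.factorial) ^ 3 := by
        rw [mul_pow, Real.sq_sqrt hM0]; ring
      rw [e, mul_pow]; exact h1'
    have h2 : (V : ℝ) * z ≤ (n : ℝ) * n.factorial * Real.sqrt ((n : ℝ) * n.factorial) :=
      (pow_le_pow_iff_left₀ (by positivity) (by positivity) two_ne_zero).1 h1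
    have hspos : 0 < Real.sqrt n := Real.sqrt_pos.2 (by exact_mod_cast hn0)
    have hnn : (n : ℝ) = Real.sqrt n * Real.sqrt n := (Real.mul_self_sqrt (Nat.cast_nonneg n)).symm
    have hq : Real.sqrt n / (4 * x) < (q : ℝ) + 1 := by
      have hA' : (n : ℝ) < 2 * t * ((q : ℝ) + 1) := by
        have := Nat.lt_mul_div_succ n (by positivity : 0 < 2 * t)
        exact_mod_cast this
      have hB : (t : ℝ) < x * Real.sqrt n + 1 := Nat.ceil_lt_add_one hxn0.le
      have hB' : (t : ℝ) ≤ 2 * (x * Real.sqrt n) := by linarith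
      have hq1 : (0 : ℝ) ≤ (q : ℝ) + 1 := by positivity
      have hC' : Real.sqrt n * Real.sqrt n < (4 * x * ((q : ℝ) + 1)) * Real.sqrt n := by
        calc Real.sqrt n * Real.sqrt n = (n : ℝ) := hnn.symm
          _ < 2 * t * ((q : ℝ) + 1) := hA'
          _ ≤ 2 * (2 * (x * Real.sqrt n)) * ((q : ℝ) + 1) := by gcongr
          _ = (4 * x * ((q : ℝ) + 1)) * Real.sqrt n := by ring
      have hD' : Real.sqrt n < 4 * x * ((q : ℝ) + 1) := lt_of_mul_lt_mul_right hC' hspos.le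
      rw [div_lt_iff₀ (by positivity)]
      linarith
    have hzexp : Real.exp (2 * c * Real.sqrt n) ≤ 2 * (z : ℝ) := by
      have e1 : 2 * c * Real.sqrt n ≤ Real.log 2 * (Real.sqrt n / (4 * x)) := by
        have := mul_le_mul_of_nonneg_right hc2 hsn
        have e : Real.log 2 * (Real.sqrt n / (4 * x)) = 2 * (Real.log 2 / (8 * x) * Real.sqrt n) := by
          field_simp; ring
        rw [e]; linarith
      have e2 : Real.log 2 * (Real.sqrt n / (4 * x)) ≤ Real.log 2 * ((q : ℝ) + 1) :=
        mul_le_mul_of_nonneg_left hq.le hlog2.le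
      have e3 : Real.log 2 * ((q : ℝ) + 1) = ((q + 1 : ℕ) : ℝ) * Real.log 2 := by push_cast; ring
      have hzq : ((2 ^ q : ℕ) : ℝ) ≤ z := by exact_mod_cast hz
      push_cast at hzq
      calc Real.exp (2 * c * Real.sqrt n) ≤ Real.exp (Real.log 2 * ((q : ℝ) + 1)) :=
            Real.exp_le_exp.2 (e1.trans e2)
        _ = 2 ^ (q + 1) := by rw [e3, Real.exp_nat_mul, Real.exp_log two_pos]
        _ = 2 * 2 ^ q := by ring
        _ ≤ 2 * z := by linarith
    apply finish c le_rfl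
    have hMsplit : (n : ℝ) * n.factorial * Real.sqrt ((n : ℝ) * n.factorial) =
        ((n : ℝ) * Real.sqrt n) * ((n.factorial : ℝ) * Real.sqrt (n.factorial : ℝ)) := by
      rw [Real.sqrt_mul (Nat.cast_nonneg n)]; ring
    have hE : (n : ℝ) * Real.sqrt n ≤ Real.exp (-(c * Real.sqrt n)) * z := by
      have h3 : Real.exp (-(c * Real.sqrt n)) * Real.exp (2 * c * Real.sqrt n) =
          Real.exp (c * Real.sqrt n) := by
        rw [← Real.exp_add]; congr 1; ring
      have h4 : 0 < Real.exp (-(c * Real.sqrt n)) := Real.exp_pos _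
      have h5 := mul_le_mul_of_nonneg_left hzexp h4.le
      rw [h3] at h5
      nlinarith [hgrow, h5]
    have hFF : (0 : ℝ) ≤ (n.factorial : ℝ) * Real.sqrt (n.factorial : ℝ) := by positivity
    have key : (V : ℝ) * z ≤
        ((n.factorial : ℝ) * Real.sqrt (n.factorial : ℝ) * Real.exp (-(c * Real.sqrt n))) * z := by
      calc (V : ℝ) * z ≤ (n : ℝ) * n.factorial * Real.sqrt ((n : ℝ) * n.factorial) := h2
        _ = ((n : ℝ) * Real.sqrt n) * ((n.factorial : ℝ) * Real.sqrt (n.factorial : ℝ)) := hMsplit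
        _ ≤ (Real.exp (-(c * Real.sqrt n)) * z) * ((n.factorial : ℝ) * Real.sqrt (n.factorial : ℝ)) :=
            mul_le_mul_of_nonneg_right hE hFF
        _ = ((n.factorial : ℝ) * Real.sqrt (n.factorial : ℝ) * Real.exp (-(c * Real.sqrt n))) * z := by
            ring
    exact le_of_mul_le_mul_right key hz0

/-- **The skeleton**: the crux modulo exactly the six registered stubs `Stub.stub_pairwisePacking`,
`Stub.stub_cycleCount`, `Stub.stub_hostSquare`, `Stub.stub_groupPacking` (all four LANDED: p75305, p76793, p75879,
p74548), `Stub.stub_triplesToGroup`, `Stub.stub_localTriples`. -/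
theorem HyperoctahedralSubsets_skeleton :
    Summit.MatrixMultiplication.MatrixMultiplication.Theses.SnSubsetDichotomy.HyperoctahedralSubsets :=
  HyperoctahedralSubsets_of Stub.stub_pairwisePacking Stub.stub_cycleCount Stub.stub_hostSquare
    Stub.stub_groupPacking (symmetryBudget_of Stub.stub_triplesToGroup Stub.stub_localTriples)

end Summit.MatrixMultiplication.MatrixMultiplication.Cruxes.HyperoctahedralSubsets.SphericalRankSieve
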